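import Summits.QuantumFields.YangMills.Theorems.FemtoTransferGapAxisPermutation
import Literature.MathematicalPhysics.QuantumFieldTheory.SpeciesTimeReflection
import HarnessLib

/-!
# The site reflection `Θ'` of the spatial three-torus is a symmetry of the femto transfer operator: kernel, a-priori measure,
# physical test functions, `transferApply`, and every raw vacuum (`φ ∘ Θ' = φ` pointwise)

Fleet-service module of seat ym-infvol-p1 g6 (route `LuscherReduction`, femto rung R2b1; bears on crux child `DressedRitz` =
stmt-QuantumFields-20205, line «polyakovlift», stub S-STAT `stub_liftStatics`).  Companion of `…FemtoTransferGapAxisPermutation.lean` (seat g5: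
the group `S₃` of axis permutations): this module adds the REFLECTION `Θ' = GaugeConfig.negReflect` of axis `0` of the spatial torus `(ℤ/L)³`
(`θ'(x₀,x₁,x₂) = (−x₀,x₁,x₂)`, links along axis `0` traversed backwards — the tree's site reflection of `ConstructiveQFTWave0SiteRPProofs`,
here applied to a SPATIAL axis of the time-zero torus of the transfer formalism).  Together, `S₃` and `Θ'` generate the full hyperoctahedral
group `B₃ ≅ O_h` (order 48) of the cubic lattice, the symmetry group under which Lüscher classifies the femto-universe levels
(`A₁^±, A₂^±, E^±, T₁^±, T₂^±`) [cite: Luscher1983, §2] [cite: LuscherMunster1984, §2].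

* §1 `timeCoupling_negReflect`, `transferKernel_negReflect` (any compact `G`, continuous `ρ`: a reversed link contributes
  `Re tr ρ(U⁻¹V) = Re tr ρ(UV⁻¹)`, `CompactGroup.re_trace_map_inv`; the Wilson action is `Θ'`-invariant, tree `wilsonAction_negReflect_eq`),
  `transferKernel_su2Rep_negReflect`; `measurePreserving_negReflectEquiv` (product Haar measure, tree `WilsonSiteRP.measurePreserving_negReflect`),
  `l2_comp_negReflect`;
* §2 `negReflect_gaugeTransform` (`Θ'(U^g) = (Θ'U)^{g∘θ'}`), `twist_mul`, `negReflect_twist_of_ne` (`Θ'` commutes with the centre twists through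
  `x_k = 0`, `k ≠ 0`), `negReflect_twist_zero` (the twist through `x₀ = 0` is carried to the INVERSE twist through the parallel plane `x₀ = −1`),
  `gaugeTransform_slab` (twists through parallel planes differ by the slab gauge transformation `g = z·𝟙_{x₀ = 0}`), ★ `IsPhys.comp_negReflect`;
* §3 `transferApply_comp_negReflect` — `K_β(ψ ∘ Θ') = (K_β ψ) ∘ Θ'`;
* §4 ★ `rawVacuum_comp_negReflect` — every physical exact top eigenfunction is `Θ'`-INVARIANT pointwise (Jentzsch simplicity, as for `S₃`).

HONEST FRAMING: fixed-lattice symmetry bookkeeping, every `L ≥ 1`, every real `β`; no renormalisation-group content; nothing here bears on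
infinite volume, the continuum limit or the Clay gap.  References: M. Lüscher, NPB 219 (1983) 233, §2 [cite: Luscher1983, §2];
K. Osterwalder, E. Seiler, Ann. Phys. 110 (1978) 440, §2 [cite: OsterwalderSeiler1978, §2]; Reed–Simon IV [cite: ReedSimonIV1978, Thm XIII.43–44].
-/

set_option autoImplicit false

noncomputable section

open MeasureTheory Filter Topology
open Literature.MathematicalPhysics.QuantumFieldTheory
open Literature.MathematicalPhysics.QuantumFieldTheory.WilsonSiteRP
open Literature.MathematicalPhysics.QuantumLattice
open scoped BigOperators

namespace Summit.QuantumFields.YangMills.Theorems.FemtoTransferGap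

open Summit.QuantumFields.YangMills.Theorems.FemtoTransferGap.PhysL2

/-! ## §1 The kernel and the a-priori measure are invariant under the reflection -/

section Kernel

variable {N : ℕ} {G : Type*} [Group G] [TopologicalSpace G] [IsTopologicalGroup G] [CompactSpace G]
  (ρ : G →* Matrix (Fin N) (Fin N) ℂ) {L : ℕ} [NeZero L]

/-- The time-like coupling `∑ₑ Re tr ρ(UₑVₑ⁻¹)` is invariant under the simultaneous reflection `Θ'` of both slices: `Θ'` permutes the links
(`siteEdgeReflect`), and a reversed link contributes `Re tr ρ(Uₑ⁻¹Vₑ) = Re tr ρ(UₑVₑ⁻¹)`. [cite: OsterwalderSeiler1978, §2] -/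
theorem timeCoupling_negReflect (hρ : Continuous ρ) (U V : GaugeConfig 3 L G) :
    timeCoupling ρ U.negReflect V.negReflect = timeCoupling ρ U V := by
  unfold timeCoupling
  have hterm : ∀ e : Edge 3 L, ((ρ (U.negReflect e * (V.negReflect e)⁻¹)).trace).re =
      ((ρ (U (siteEdgeReflect e) * (V (siteEdgeReflect e))⁻¹)).trace).re := fun e => by
    rw [negReflect_apply, negReflect_apply]
    split_ifs with h
    · rw [inv_inv, show (U (siteEdgeReflect e))⁻¹ * V (siteEdgeReflect e) = ((V (siteEdgeReflect e))⁻¹ * U (siteEdgeReflect e))⁻¹ by group,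
        Literature.RepresentationTheory.CompactGroups.CompactGroup.re_trace_map_inv ρ hρ, map_mul, map_mul, Matrix.trace_mul_comm]
    · rfl
  simp_rw [hterm]
  exact Equiv.sum_comp siteEdgeReflectEquiv (fun e => ((ρ (U e * (V e)⁻¹)).trace).re)

/-- **The spatial transfer kernel is invariant under the reflection**: `K_β(Θ'U, Θ'V) = K_β(U, V)` (time coupling: `timeCoupling_negReflect`;
Wilson action: tree `wilsonAction_negReflect_eq`). [cite: Luscher1983, §2] [cite: OsterwalderSeiler1978, §2] -/
theorem transferKernel_negReflect (hρ : Continuous ρ) (β : ℝ) (U V : GaugeConfig 3 L G) :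
    transferKernel ρ β U.negReflect V.negReflect = transferKernel ρ β U V := by
  unfold transferKernel
  rw [timeCoupling_negReflect ρ hρ, wilsonAction_negReflect_eq ρ hρ, wilsonAction_negReflect_eq ρ hρ]

variable [MeasurableSpace G] [BorelSpace G]

/-- The reflection, as a measurable equivalence (tree `WilsonSiteRP.negReflectEquiv`), preserves the a-priori product Haar measure `configMeasure`
(tree `WilsonSiteRP.measurePreserving_negReflect`). [folklore] -/
theorem measurePreserving_negReflectEquiv :
    MeasurePreserving (negReflectEquiv (d := 3) (L := L) (G := G)) (configMeasure G L) (configMeasure G L) :=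
  WilsonSiteRP.measurePreserving_negReflect (d := 3) (L := L) (G := G)

/-- `⟨ψ ∘ Θ', φ ∘ Θ'⟩ = ⟨ψ, φ⟩`. [folklore] -/
theorem l2_comp_negReflect (ψ φ : GaugeConfig 3 L G → ℝ) :
    l2 (fun U => ψ U.negReflect) (fun U => φ U.negReflect) = l2 ψ φ := by
  unfold l2
  exact (measurePreserving_negReflectEquiv (G := G)).integral_comp' (f := negReflectEquiv) (fun U => ψ U * φ U)

end Kernel

section KernelSU2

variable {L : ℕ} [NeZero L]

/-- The `SU(2)` spatial transfer kernel is `Θ'`-invariant. [cite: Luscher1983, §2] -/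
theorem transferKernel_su2Rep_negReflect (β : ℝ) (U V : GaugeConfig 3 L SU2) :
    transferKernel su2Rep β U.negReflect V.negReflect = transferKernel su2Rep β U V :=
  transferKernel_negReflect su2Rep continuous_su2Rep β U V

end KernelSU2

/-! ## §2 The reflection conjugates gauge transformations and centre twists; physical test functions stay physical -/

section Phys

variable {G : Type*} [Group G] {L : ℕ}

/-- `Θ'(U^g) = (Θ'U)^{g ∘ θ'}`: the reflection conjugates a gauge transformation into a gauge transformation. [folklore] -/
theorem negReflect_gaugeTransform (g : Site 3 L → G) (U : GaugeConfig 3 L G) :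
    (gaugeTransform g U).negReflect = gaugeTransform (fun x => g x.negReflect) U.negReflect := by
  funext e
  obtain ⟨x, μ⟩ := e
  by_cases hμ : μ = 0
  · subst hμ
    have h1 : ((x.shift 0).negReflect.shift 0) = x.negReflect := negReflect_shift_shift x
    simp only [GaugeConfig.negReflect, gaugeTransform, if_true, h1, mul_inv_rev, inv_inv, mul_assoc]
  · have h1 : (x.shift μ).negReflect = x.negReflect.shift μ := negReflect_shift_of_ne x hμ
    simp only [GaugeConfig.negReflect, gaugeTransform, hμ, if_false, h1]

/-- Two twists through the same plane compose: `twist_k a (twist_k b U) = twist_k (ab) U`. [folklore] -/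
theorem twist_mul (k : Fin 3) (a b : G) (U : GaugeConfig 3 L G) : twist k a (twist k b U) = twist k (a * b) U := by
  funext e
  by_cases h : e.2 = k ∧ e.1 k = 0
  · simp only [twist, h, and_self, if_true, mul_assoc]
  · simp only [twist, h, if_false]

/-- `Θ'` commutes with the centre twist through the plane `x_k = 0` for `k ≠ 0` (that plane and its links are carried to themselves). [cite: tHooft1979] -/
theorem negReflect_twist_of_ne {k : Fin 3} (hk : k ≠ 0) (z : G) (U : GaugeConfig 3 L G) :
    (twist k z U).negReflect = twist k z U.negReflect := by
  funext e
  obtain ⟨x, μ⟩ := e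
  by_cases hμ : μ = 0
  · subst hμ
    have hk' : ¬ ((0 : Fin 3) = k) := fun h => hk h.symm
    simp only [GaugeConfig.negReflect, twist, if_true, hk', false_and, if_false]
  · have hxk : x.negReflect k = x k := negReflect_apply_of_ne x hk
    simp only [GaugeConfig.negReflect, twist, hμ, if_false, hxk]

/-- `Θ'` carries the centre twist by `z` through the plane `x₀ = 0` to the twist by `z⁻¹` through the PARALLEL plane `x₀ = −1` (the links `(x,0)` with
`(x + e₀)₀ = 0`), for central `z`. [cite: tHooft1979] -/
theorem negReflect_twist_zero {z : G} (hz : z ∈ Subgroup.center G) (U : GaugeConfig 3 L G) :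
    (twist 0 z U).negReflect = fun e => if e.2 = 0 ∧ (e.1.shift 0) 0 = 0 then z⁻¹ * U.negReflect e else U.negReflect e := by
  have hzc : ∀ g : G, g * z⁻¹ = z⁻¹ * g := fun g => by
    have := Subgroup.mem_center_iff.mp (Subgroup.inv_mem _ hz) g
    exact this
  funext e
  obtain ⟨x, μ⟩ := e
  by_cases hμ : μ = 0
  · subst hμ
    have hy : ((x.shift 0).negReflect 0 = 0) ↔ ((x.shift 0) 0 = 0) := by
      rw [negReflect_apply_zero, neg_eq_zero]
    by_cases hx : (x.shift 0) 0 = 0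
    · have hy' : (x.shift 0).negReflect 0 = 0 := hy.mpr hx
      simp only [GaugeConfig.negReflect, twist, if_true, hy', and_self, hx, mul_inv_rev, hzc]
    · have hy' : ¬ ((x.shift 0).negReflect 0 = 0) := fun h => hx (hy.mp h)
      simp only [GaugeConfig.negReflect, twist, if_true, hy', and_false, if_false, hx]
  · simp only [GaugeConfig.negReflect, twist, hμ, if_false, false_and]

/-- Twists through parallel planes differ by a gauge transformation: with the slab gauge function `g(x) = z` if `x₀ = 0`, `g(x) = 1` otherwise
(`z` central), `W^g = twist₀(z) (twist'₀(z⁻¹) W)`, where `twist'₀` is the twist through the plane `x₀ = −1` of `negReflect_twist_zero`. [cite: tHooft1979] -/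
theorem gaugeTransform_slab {z : G} (hz : z ∈ Subgroup.center G) (W : GaugeConfig 3 L G) :
    gaugeTransform (fun x : Site 3 L => if x 0 = 0 then z else 1) W =
      twist 0 z (fun e => if e.2 = 0 ∧ (e.1.shift 0) 0 = 0 then z⁻¹ * W e else W e) := by
  have hzc : ∀ g : G, g * z = z * g := fun g => Subgroup.mem_center_iff.mp hz g
  have hzc' : ∀ g : G, g * z⁻¹ = z⁻¹ * g := fun g => Subgroup.mem_center_iff.mp (Subgroup.inv_mem _ hz) g
  funext e
  obtain ⟨x, μ⟩ := e
  by_cases hμ : μ = 0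
  · subst hμ
    by_cases hA : x 0 = 0
    · by_cases hB : (x.shift 0) 0 = 0
      · simp only [gaugeTransform, twist, hA, hB, if_true, and_self, mul_inv_cancel_left]
        rw [← hzc, mul_inv_cancel_right]
      · simp only [gaugeTransform, twist, hA, hB, if_true, if_false, and_false, and_true, inv_one, mul_one]
    · by_cases hB : (x.shift 0) 0 = 0
      · simp only [gaugeTransform, twist, hA, hB, if_true, if_false, and_true, and_false, one_mul]
        exact hzc' _
      · simp only [gaugeTransform, twist, hA, hB, if_false, and_false, one_mul, inv_one, mul_one]
  · have hs : (x.shift μ) 0 = x 0 := WilsonRP.shift_apply_of_ne x (fun h => hμ h.symm)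
    by_cases hA : x 0 = 0
    · simp only [gaugeTransform, twist, hμ, hs, hA, if_true, false_and, if_false]
      rw [← hzc, mul_inv_cancel_right]
    · simp only [gaugeTransform, twist, hμ, hs, hA, if_false, false_and, one_mul, inv_one, mul_one]

variable [TopologicalSpace G] [IsTopologicalGroup G] [MeasurableSpace G] [BorelSpace G]

/-- ★ **`ψ ∘ Θ'` is a physical zero-flux test function when `ψ` is**: measurable (`WilsonSiteRP.measurable_negReflect`), bounded, gauge invariant
(`negReflect_gaugeTransform`), and twist invariant — directly for the planes `x_k = 0`, `k ≠ 0` (`negReflect_twist_of_ne`), and for `k = 0` because the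
reflected twist is the inverse twist through the parallel plane `x₀ = −1`, which is the original twist up to the slab gauge transformation
(`negReflect_twist_zero`, `gaugeTransform_slab`, `twist_mul`). [cite: Luscher1983, §2] [cite: tHooft1979] -/
theorem IsPhys.comp_negReflect {ψ : GaugeConfig 3 L G → ℝ} (hψ : IsPhys ψ) : IsPhys fun U => ψ U.negReflect := by
  obtain ⟨C, hC⟩ := hψ.bounded
  refine ⟨hψ.measurable.comp WilsonSiteRP.measurable_negReflect, ⟨C, fun U => hC _⟩, fun g U => ?_, fun k z hz U => ?_⟩
  · show ψ (gaugeTransform g U).negReflect = ψ U.negReflect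
    rw [negReflect_gaugeTransform, hψ.gaugeInv]
  · show ψ (twist k z U).negReflect = ψ U.negReflect
    by_cases hk : k = 0
    · subst hk
      set W := U.negReflect with hW
      have hzi : z⁻¹ ∈ Subgroup.center G := Subgroup.inv_mem _ hz
      -- the reflected twist is `twist'₀(z⁻¹) W = twist₀(z⁻¹) (W^g)`
      have key : (fun e => if e.2 = 0 ∧ (e.1.shift 0) 0 = 0 then z⁻¹ * W e else W e) =
          twist 0 z⁻¹ (gaugeTransform (fun x : Site 3 L => if x 0 = 0 then z else 1) W) := by
        rw [gaugeTransform_slab hz W, twist_mul, inv_mul_cancel, twist_one]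
      rw [negReflect_twist_zero hz, ← hW, key, hψ.zeroFlux 0 z⁻¹ hzi, hψ.gaugeInv]
    · rw [negReflect_twist_of_ne hk, hψ.zeroFlux k z hz]

end Phys

/-! ## §3 The transfer operator commutes with the reflection -/

section Apply

variable {L : ℕ} [NeZero L]

/-- **`K_β (ψ ∘ Θ') = (K_β ψ) ∘ Θ'`** (change of variables `V = Θ'W` in `∫ K_β(Θ'U, V) ψ(V) dV`, kernel invariance, measure preservation).
[cite: Luscher1983, §2] -/
theorem transferApply_comp_negReflect (β : ℝ) (ψ : GaugeConfig 3 L SU2 → ℝ) :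
    transferApply β (fun U => ψ U.negReflect) = fun U => transferApply β ψ U.negReflect := by
  funext U
  rw [transferApply_apply, transferApply_apply,
    ← (measurePreserving_negReflectEquiv (G := SU2)).integral_comp' (f := negReflectEquiv)
      (fun V => transferKernel su2Rep β U.negReflect V * ψ V)]
  show _ = ∫ W, transferKernel su2Rep β U.negReflect W.negReflect * ψ W.negReflect ∂(configMeasure SU2 L)
  simp only [transferKernel_su2Rep_negReflect]

/-- Iterated form: `K_β^[m] (ψ ∘ Θ') = (K_β^[m] ψ) ∘ Θ'`. [cite: Luscher1983, §2] -/
theorem iterate_transferApply_comp_negReflect (β : ℝ) (ψ : GaugeConfig 3 L SU2 → ℝ) :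
    ∀ m : ℕ, (transferApply β)^[m] (fun U => ψ U.negReflect) = fun U => (transferApply β)^[m] ψ U.negReflect
  | 0 => rfl
  | m + 1 => by
    rw [Function.iterate_succ_apply', Function.iterate_succ_apply', iterate_transferApply_comp_negReflect β ψ m,
      transferApply_comp_negReflect]

end Apply

/-! ## §4 ★ Every raw vacuum is invariant under the reflection -/

section Vacuum

variable {L : ℕ} [NeZero L]

/-- **A raw vacuum is `Θ'`-invariant, pointwise**: if `φ` is physical and `K_βφ = λ₀φ` pointwise then `φ (Θ'U) = φ U` for every `U`.  Proof as for
axis permutations: the Perron–Frobenius state `Ω > 0` composed with `Θ'` is again physical (§2), normalised (§1), an exact top eigenfunction (§3)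
and positive, so by Jentzsch's simplicity (`rawVacuum_eq_smul_of_gap`) `Ω ∘ Θ' = bΩ` with `b > 0`, `b² = 1`; and `φ = aΩ`.
[cite: ReedSimonIV1978, Thm XIII.43 and Thm XIII.44] [cite: Luscher1983, §2] -/
theorem rawVacuum_comp_negReflect (β : ℝ) {φ : GaugeConfig 3 L SU2 → ℝ} (hφ : IsPhys φ)
    (heig : transferApply β φ = levelValue su2Rep L β 0 • φ) (U : GaugeConfig 3 L SU2) :
    φ U.negReflect = φ U := by
  obtain ⟨Ω, θ, c, hΩ, hc, hcle, hn, heigΩ, -, hθ, hgap⟩ := PhysL2.exists_groundState (L := L) β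
  rw [levelValue_zero] at heig
  -- `φ = a Ω`
  have hφΩ := PolyakovLift.rawVacuum_eq_smul_of_gap β hφ heig hΩ hn heigΩ hθ hgap
  -- `Ω ∘ Θ'` is a positive normalised physical top eigenfunction
  set ΩP : GaugeConfig 3 L SU2 → ℝ := fun V => Ω V.negReflect with hΩP
  have hΩP_phys : IsPhys ΩP := hΩ.comp_negReflect
  have hΩP_eig : transferApply β ΩP = topValue su2Rep L β • ΩP := by
    rw [hΩP, transferApply_comp_negReflect, heigΩ]
    funext V
    simp only [Pi.smul_apply, smul_eq_mul]
  have hΩPΩ := PolyakovLift.rawVacuum_eq_smul_of_gap β hΩP_phys hΩP_eig hΩ hn heigΩ hθ hgap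
  set b : ℝ := l2 ΩP Ω with hb
  -- `b > 0` (both states positive) and `b² = 1` (both normalised), so `b = 1`
  have hbpos : 0 < b := by
    have h1 : ΩP U = b * Ω U := hΩPΩ U
    have hΩPU : 0 < ΩP U := hc.trans_le (hcle _)
    have hΩU : 0 < Ω U := hc.trans_le (hcle U)
    by_contra hle
    push Not at hle
    have : ΩP U ≤ 0 := by rw [h1]; exact mul_nonpos_of_nonpos_of_nonneg hle hΩU.le
    exact absurd this (not_le.mpr hΩPU)
  have hnormP : l2 ΩP ΩP = 1 := by rw [hΩP, l2_comp_negReflect, hn]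
  have hb1 : b = 1 := by
    have hfun : ΩP = b • Ω := funext fun V => by rw [Pi.smul_apply, smul_eq_mul]; exact hΩPΩ V
    have h2 : l2 ΩP ΩP = b * b * l2 Ω Ω := by rw [hfun, OpPlat.l2_smul_smul]
    rw [hnormP, hn, mul_one] at h2
    nlinarith
  -- conclude
  have hΩinv : Ω U.negReflect = Ω U := by
    have h := hΩPΩ U
    rw [hb1, one_mul] at h
    exact h
  rw [hφΩ U.negReflect, hφΩ U, hΩinv]

/-- Function form: `φ ∘ Θ' = φ` for a raw vacuum `φ`. [cite: ReedSimonIV1978, Thm XIII.43 and Thm XIII.44] -/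
theorem rawVacuum_comp_negReflect_eq (β : ℝ) {φ : GaugeConfig 3 L SU2 → ℝ} (hφ : IsPhys φ)
    (heig : transferApply β φ = levelValue su2Rep L β 0 • φ) :
    (fun U => φ U.negReflect) = φ :=
  funext fun U => rawVacuum_comp_negReflect β hφ heig U

end Vacuum

end Summit.QuantumFields.YangMills.Theorems.FemtoTransferGap

end
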